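import Literature.NumberTheory.LFunctions.WeilTwoPrimeDeflM75YBase
import Literature.NumberTheory.LFunctions.WeilBlockRowsFast
import HarnessLib

/-!
# Deflated two-prime certificate (weilCertDeflM75Y): the Bessel block claim `Hp = C H Cᵀ` (parity 1), rows 20–24, fast check

`WeilCert.checkHpRowT` (linear traversals) instead of the indexed `checkHpRow` decide.  Pure proof file.
-/

noncomputable section

namespace Summit.RiemannHypothesis.RiemannHypothesis.Theorems.EvenWinsBeyondArch

open Literature.NumberTheory.LFunctions

set_option maxHeartbeats 0 in
/-- Fast kernel check of claim row 20 of `Hp = C H Cᵀ` (parity 1; linear traversals, triangular `C`). [folklore] -/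
theorem checkHpRowT1_20_weilCertDeflM75Y : weilCertDeflM75YBase.checkHpRowT weilCertDeflM75YHpO 1 20 = true := by
  decide +kernel

/-- Claim row 20 of `Hp = C H Cᵀ` (parity 1), from the fast check. [folklore] -/
theorem checkHpRow1_20_weilCertDeflM75Y : weilCertDeflM75YBase.checkHpRow weilCertDeflM75YHpO 1 20 = true :=
  WeilCert.checkHpRow_of_T checkHpRowT1_20_weilCertDeflM75Y

set_option maxHeartbeats 0 in
/-- Fast kernel check of claim row 21 of `Hp = C H Cᵀ` (parity 1; linear traversals, triangular `C`). [folklore] -/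
theorem checkHpRowT1_21_weilCertDeflM75Y : weilCertDeflM75YBase.checkHpRowT weilCertDeflM75YHpO 1 21 = true := by
  decide +kernel

/-- Claim row 21 of `Hp = C H Cᵀ` (parity 1), from the fast check. [folklore] -/
theorem checkHpRow1_21_weilCertDeflM75Y : weilCertDeflM75YBase.checkHpRow weilCertDeflM75YHpO 1 21 = true :=
  WeilCert.checkHpRow_of_T checkHpRowT1_21_weilCertDeflM75Y

set_option maxHeartbeats 0 in
/-- Fast kernel check of claim row 22 of `Hp = C H Cᵀ` (parity 1; linear traversals, triangular `C`). [folklore] -/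
theorem checkHpRowT1_22_weilCertDeflM75Y : weilCertDeflM75YBase.checkHpRowT weilCertDeflM75YHpO 1 22 = true := by
  decide +kernel

/-- Claim row 22 of `Hp = C H Cᵀ` (parity 1), from the fast check. [folklore] -/
theorem checkHpRow1_22_weilCertDeflM75Y : weilCertDeflM75YBase.checkHpRow weilCertDeflM75YHpO 1 22 = true :=
  WeilCert.checkHpRow_of_T checkHpRowT1_22_weilCertDeflM75Y

set_option maxHeartbeats 0 in
/-- Fast kernel check of claim row 23 of `Hp = C H Cᵀ` (parity 1; linear traversals, triangular `C`). [folklore] -/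
theorem checkHpRowT1_23_weilCertDeflM75Y : weilCertDeflM75YBase.checkHpRowT weilCertDeflM75YHpO 1 23 = true := by
  decide +kernel

/-- Claim row 23 of `Hp = C H Cᵀ` (parity 1), from the fast check. [folklore] -/
theorem checkHpRow1_23_weilCertDeflM75Y : weilCertDeflM75YBase.checkHpRow weilCertDeflM75YHpO 1 23 = true :=
  WeilCert.checkHpRow_of_T checkHpRowT1_23_weilCertDeflM75Y

set_option maxHeartbeats 0 in
/-- Fast kernel check of claim row 24 of `Hp = C H Cᵀ` (parity 1; linear traversals, triangular `C`). [folklore] -/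
theorem checkHpRowT1_24_weilCertDeflM75Y : weilCertDeflM75YBase.checkHpRowT weilCertDeflM75YHpO 1 24 = true := by
  decide +kernel

/-- Claim row 24 of `Hp = C H Cᵀ` (parity 1), from the fast check. [folklore] -/
theorem checkHpRow1_24_weilCertDeflM75Y : weilCertDeflM75YBase.checkHpRow weilCertDeflM75YHpO 1 24 = true :=
  WeilCert.checkHpRow_of_T checkHpRowT1_24_weilCertDeflM75Y

end Summit.RiemannHypothesis.RiemannHypothesis.Theorems.EvenWinsBeyondArch
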